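import Summits.Ventures.PercRepro.C026TwoCluster

/-!
# The principal cluster-cube theorem (p6, gen 20)

mine-3's certificate system of record for ROW C-041 (MINE3-GLUING §42, (CC)) pays every Bad source
inside its **cluster cube** `[T, FILL(T)] = {T ∪ X : X ⊆ the blue edges inside D₁(T) ∪ D₂(T)}`, where
`D_t(T)` is the blue cluster of the live vertex `t`.  Its principal case is the two-cluster theorem of
`C026TwoCluster` applied to complementary subsets of the cluster-interior blue edges instead of all
blue edges.  For a `(D,A)` source `S`, a set `I` of `S`-blue edges that contains every `S`-blue edge
with both ends in the blue cluster of `a` and every `S`-blue edge with both ends in the blue cluster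
of `b`, and any `X` (in particular `X ≤ I`):

  `S ⊔ X ∈ Good₁  ∨  S ⊔ (I ⊓ Xᶜ) ∈ Good₂`                     (`good_or_good_compl_of_le`),

hence (`card_cube_le_good_add_good_of_le`)

  `#{T : S ≤ T ≤ S ⊔ I} ≤ #{T ∈ cube : Good₁ T} + #{T ∈ cube : Good₂ T}`

— the average Good-degree over the cluster cube of any `(D,A)` source is at least `1`.  With `I = Sᶜ`
this is the principal-cube theorem `card_cube_le_good_add_good` of `C026TwoCluster`; with `I` = the
cluster-interior blue edges it is the principal case of (CC).  The proof is that of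
`good_or_good_compl`: a blue edge of `S ⊔ (I ⊓ Xᶜ)` inside the blue cluster of `b` lies in `I` and not
in `I ⊓ Xᶜ`, hence in `X`, hence is open in `S ⊔ X` — and symmetrically; the involution
`T ↦ S ⊔ (I ⊓ Tᶜ)` of the cube carries the second alternative to `Good₂`.
-/

namespace PercRepro

namespace MultiGraph

open Finset

variable {V E : Type*} {G : MultiGraph V E}

/-- Boolean evaluation of `(s ⊔ (i ⊓ xᶜ))ᶜ = true`. -/
theorem bool_compl_sup_inf_compl_eq_true_iff (s i x : Bool) :
    (s ⊔ (i ⊓ xᶜ))ᶜ = true ↔ s = false ∧ (i = true → x = true) := by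
  cases s <;> cases i <;> cases x <;> decide

/-- Boolean evaluation of `(s ⊔ x)ᶜ = true`. -/
theorem bool_compl_sup_eq_true_iff (s x : Bool) : (s ⊔ x)ᶜ = true ↔ s = false ∧ x = false := by
  cases s <;> cases x <;> decide

/-- Boolean evaluation of `s ⊔ x = true`. -/
theorem bool_sup_eq_true_iff (s x : Bool) : s ⊔ x = true ↔ s = true ∨ x = true := by
  cases s <;> cases x <;> decide

/-- Boolean evaluation of `s ⊔ (i ⊓ xᶜ) = true`. -/
theorem bool_sup_inf_compl_eq_true_iff (s i x : Bool) :
    s ⊔ (i ⊓ xᶜ) = true ↔ s = true ∨ (i = true ∧ x = false) := by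
  cases s <;> cases i <;> cases x <;> decide

/-- The Boolean identity behind the cube involution `T ↦ S ⊔ (I ⊓ Tᶜ)`. -/
theorem bool_cube_involution (s i t : Bool) (h1 : i ≤ sᶜ) (h2 : s ≤ t) (h3 : t ≤ s ⊔ i) :
    s ⊔ (i ⊓ (s ⊔ (i ⊓ tᶜ))ᶜ) = t := by
  revert h1 h2 h3
  cases s <;> cases i <;> cases t <;> decide

/-- Every vertex of the blue cluster of `b` in `S ⊔ (I ⊓ Xᶜ)` reaches `b` inside that cluster by edges
open in `S ⊔ X` (the cluster-interior blue edges of `S ⊔ (I ⊓ Xᶜ)` lie in `X`). -/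
theorem walkInside_cluster_compl_sup_inf_compl {S I X : Config E} {b : V}
    (hIb : ∀ e, Sᶜ e = true → G.fst e ∈ G.cluster Sᶜ b → G.snd e ∈ G.cluster Sᶜ b → I e = true)
    {x : V} (hx : x ∈ G.cluster (S ⊔ (I ⊓ Xᶜ))ᶜ b) :
    G.WalkInside (S ⊔ X) (G.cluster (S ⊔ (I ⊓ Xᶜ))ᶜ b) x b := by
  have hsub : G.cluster (S ⊔ (I ⊓ Xᶜ))ᶜ b ⊆ G.cluster Sᶜ b := by
    refine G.cluster_mono ?_ b
    rw [compl_sup]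
    exact inf_le_left
  refine ⟨hx, ?_⟩
  have h : G.Conn (S ⊔ (I ⊓ Xᶜ))ᶜ x b := ((G.mem_cluster).1 hx).symm
  unfold Conn at h
  induction h using Relation.ReflTransGen.head_induction_on with
  | refl => exact Relation.ReflTransGen.refl
  | @head x y hxy hyb ih =>
    have hy : y ∈ G.cluster (S ⊔ (I ⊓ Xᶜ))ᶜ b := (G.mem_cluster).2 (Conn.symm (G := G) hyb)
    have hx' : x ∈ G.cluster (S ⊔ (I ⊓ Xᶜ))ᶜ b :=
      (G.mem_cluster).2 (Conn.symm (G := G) (Relation.ReflTransGen.head hxy hyb))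
    refine Relation.ReflTransGen.head ⟨?_, hy⟩ (ih hy)
    obtain ⟨e, he, hend⟩ := hxy
    refine ⟨e, ?_, hend⟩
    rw [Pi.compl_apply, Pi.sup_apply, Pi.inf_apply, Pi.compl_apply,
      bool_compl_sup_inf_compl_eq_true_iff] at he
    have hfst : G.fst e ∈ G.cluster Sᶜ b := by
      rcases hend with ⟨h1, _⟩ | ⟨h1, _⟩
      · rw [h1]; exact hsub hx'
      · rw [h1]; exact hsub hy
    have hsnd : G.snd e ∈ G.cluster Sᶜ b := by
      rcases hend with ⟨_, h2⟩ | ⟨_, h2⟩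
      · rw [h2]; exact hsub hy
      · rw [h2]; exact hsub hx'
    have hSe : Sᶜ e = true := by
      rw [Pi.compl_apply, he.1]
      rfl
    have hXe : X e = true := he.2 (hIb e hSe hfst hsnd)
    rw [Pi.sup_apply, bool_sup_eq_true_iff]
    exact Or.inr hXe

/-- Every vertex of the blue cluster of `a` in `S ⊔ X` reaches `a` inside that cluster by edges open
in `S ⊔ (I ⊓ Xᶜ)` (the cluster-interior blue edges of `S ⊔ X` lie in `I ⊓ Xᶜ`). -/
theorem walkInside_cluster_compl_sup {S I X : Config E} {a : V}
    (hIa : ∀ e, Sᶜ e = true → G.fst e ∈ G.cluster Sᶜ a → G.snd e ∈ G.cluster Sᶜ a → I e = true)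
    {x : V} (hx : x ∈ G.cluster (S ⊔ X)ᶜ a) :
    G.WalkInside (S ⊔ (I ⊓ Xᶜ)) (G.cluster (S ⊔ X)ᶜ a) x a := by
  have hsub : G.cluster (S ⊔ X)ᶜ a ⊆ G.cluster Sᶜ a := by
    refine G.cluster_mono ?_ a
    rw [compl_sup]
    exact inf_le_left
  refine ⟨hx, ?_⟩
  have h : G.Conn (S ⊔ X)ᶜ x a := ((G.mem_cluster).1 hx).symm
  unfold Conn at h
  induction h using Relation.ReflTransGen.head_induction_on with
  | refl => exact Relation.ReflTransGen.refl
  | @head x y hxy hya ih =>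
    have hy : y ∈ G.cluster (S ⊔ X)ᶜ a := (G.mem_cluster).2 (Conn.symm (G := G) hya)
    have hx' : x ∈ G.cluster (S ⊔ X)ᶜ a :=
      (G.mem_cluster).2 (Conn.symm (G := G) (Relation.ReflTransGen.head hxy hya))
    refine Relation.ReflTransGen.head ⟨?_, hy⟩ (ih hy)
    obtain ⟨e, he, hend⟩ := hxy
    refine ⟨e, ?_, hend⟩
    rw [Pi.compl_apply, Pi.sup_apply, bool_compl_sup_eq_true_iff] at he
    have hfst : G.fst e ∈ G.cluster Sᶜ a := by
      rcases hend with ⟨h1, _⟩ | ⟨h1, _⟩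
      · rw [h1]; exact hsub hx'
      · rw [h1]; exact hsub hy
    have hsnd : G.snd e ∈ G.cluster Sᶜ a := by
      rcases hend with ⟨_, h2⟩ | ⟨_, h2⟩
      · rw [h2]; exact hsub hy
      · rw [h2]; exact hsub hx'
    have hSe : Sᶜ e = true := by
      rw [Pi.compl_apply, he.1]
      rfl
    have hIe : I e = true := hIa e hSe hfst hsnd
    rw [Pi.sup_apply, Pi.inf_apply, Pi.compl_apply, bool_sup_inf_compl_eq_true_iff]
    exact Or.inr ⟨hIe, he.2⟩

/-- **The cluster-cube complement lemma.** For `S` with `c ~_S a` and disjoint blue clusters of `a`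
and `b`, a set `I` containing every `S`-blue edge inside the blue cluster of `a` and every `S`-blue
edge inside the blue cluster of `b`, and any `X` (the case of interest is `X ≤ I ≤ Sᶜ`): either `c`
reaches `b` in `S ⊔ X` avoiding the blue cluster of `a` there, or `c` reaches `a` in `S ⊔ (I ⊓ Xᶜ)`
avoiding the blue cluster of `b` there. -/
theorem good_or_good_compl_of_le {S I X : Config E} {a b c : V} (hca : G.Conn S c a)
    (hdisj : Disjoint (G.cluster Sᶜ a) (G.cluster Sᶜ b))
    (hIa : ∀ e, Sᶜ e = true → G.fst e ∈ G.cluster Sᶜ a → G.snd e ∈ G.cluster Sᶜ a → I e = true)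
    (hIb : ∀ e, Sᶜ e = true → G.fst e ∈ G.cluster Sᶜ b → G.snd e ∈ G.cluster Sᶜ b → I e = true) :
    G.WalkAvoiding (S ⊔ X) (G.cluster (S ⊔ X)ᶜ a) c b ∨
      G.WalkAvoiding (S ⊔ (I ⊓ Xᶜ)) (G.cluster (S ⊔ (I ⊓ Xᶜ))ᶜ b) c a := by
  refine two_cluster (Y₁ := G.cluster (S ⊔ X)ᶜ a) (Y₂ := G.cluster (S ⊔ (I ⊓ Xᶜ))ᶜ b) ?_ ?_ ?_ ?_
  · -- (H1): both blue clusters shrink when blue edges are opened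
    refine hdisj.mono (G.cluster_mono ?_ a) (G.cluster_mono ?_ b)
    · rw [compl_sup]
      exact inf_le_left
    · rw [compl_sup]
      exact inf_le_left
  · exact fun x hx => walkInside_cluster_compl_sup_inf_compl hIb hx
  · exact fun x hx => walkInside_cluster_compl_sup hIa hx
  · -- (H4): an `S`-open path from `c` to `a`, cut at its first vertex in the blue cluster of `a`
    obtain ⟨w, hw, hwalk⟩ := exists_first_mem_of_conn hca (G.self_mem_cluster (S ⊔ X)ᶜ a)
    exact ⟨w, hw, reflTransGen_of_imp
      (fun _ _ hxy => ⟨hxy.1.mono (le_inf le_sup_left le_sup_left), hxy.2⟩) hwalk⟩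

section Cube

variable [Fintype E] [DecidableEq E]

omit [Fintype E] [DecidableEq E] in
/-- The map `T ↦ S ⊔ (I ⊓ Tᶜ)` is an involution of the cube `{T : S ≤ T ≤ S ⊔ I}` when `I ≤ Sᶜ`. -/
theorem cube_compl_compl_of_le {S I T : Config E} (hI : I ≤ Sᶜ) (hST : S ≤ T) (hTI : T ≤ S ⊔ I) :
    S ⊔ (I ⊓ (S ⊔ (I ⊓ Tᶜ))ᶜ) = T := by
  funext e
  have h1 : I e ≤ (S e)ᶜ := by
    have := hI e
    rwa [Pi.compl_apply] at this
  have h2 : S e ≤ T e := hST e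
  have h3 : T e ≤ S e ⊔ I e := by
    have := hTI e
    rwa [Pi.sup_apply] at this
  simp only [Pi.sup_apply, Pi.inf_apply, Pi.compl_apply]
  exact bool_cube_involution (S e) (I e) (T e) h1 h2 h3

omit [Fintype E] [DecidableEq E] in
/-- A member of the cube is `S ⊔ (I ⊓ T)`. -/
theorem sup_inf_eq_of_mem_cube {S I T : Config E} (hST : S ≤ T) (hTI : T ≤ S ⊔ I) :
    S ⊔ (I ⊓ T) = T := by
  rw [sup_inf_left, sup_eq_right.2 hST, inf_eq_right.2 hTI]

omit [Fintype E] [DecidableEq E] in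
/-- The complement within `I` of `I ⊓ T` is `I ⊓ Tᶜ`. -/
theorem inf_compl_inf_eq {I T : Config E} : I ⊓ (I ⊓ T)ᶜ = I ⊓ Tᶜ := by
  rw [compl_inf, inf_sup_left, inf_compl_eq_bot, bot_sup_eq]

open Classical in
/-- **THEOREM (principal cluster cube).** For `S` with `c ~_S a` and disjoint blue clusters of `a`
and `b`, and a set `I` of `S`-blue edges containing every `S`-blue edge inside the blue cluster of `a`
or inside the blue cluster of `b`, the cube `{T : S ≤ T ≤ S ⊔ I}` satisfies
`#cube ≤ #{T ∈ cube : Good₁ T} + #{T ∈ cube : Good₂ T}` — the average Good-degree over the cluster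
cube of any `(D,A)` source is at least `1` (the principal case of mine-3's (CC); `I = Sᶜ` gives back
`card_cube_le_good_add_good`). -/
theorem card_cube_le_good_add_good_of_le {S I : Config E} {a b c : V} (hca : G.Conn S c a)
    (hdisj : Disjoint (G.cluster Sᶜ a) (G.cluster Sᶜ b)) (hI : I ≤ Sᶜ)
    (hIa : ∀ e, Sᶜ e = true → G.fst e ∈ G.cluster Sᶜ a → G.snd e ∈ G.cluster Sᶜ a → I e = true)
    (hIb : ∀ e, Sᶜ e = true → G.fst e ∈ G.cluster Sᶜ b → G.snd e ∈ G.cluster Sᶜ b → I e = true) :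
    (univ.filter fun T : Config E => S ≤ T ∧ T ≤ S ⊔ I).card ≤
      (univ.filter fun T : Config E => (S ≤ T ∧ T ≤ S ⊔ I) ∧
        G.WalkAvoiding T (G.cluster Tᶜ a) c b).card +
      (univ.filter fun T : Config E => (S ≤ T ∧ T ≤ S ⊔ I) ∧
        G.WalkAvoiding T (G.cluster Tᶜ b) c a).card := by
  -- the cube is covered by `Good₁` and the preimage of `Good₂` under the involution
  have hcover : (univ.filter fun T : Config E => S ≤ T ∧ T ≤ S ⊔ I) ⊆
      (univ.filter fun T : Config E => (S ≤ T ∧ T ≤ S ⊔ I) ∧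
        G.WalkAvoiding T (G.cluster Tᶜ a) c b) ∪
      (univ.filter fun T : Config E => (S ≤ T ∧ T ≤ S ⊔ I) ∧
        G.WalkAvoiding (S ⊔ (I ⊓ Tᶜ)) (G.cluster (S ⊔ (I ⊓ Tᶜ))ᶜ b) c a) := by
    intro T hT
    simp only [mem_filter, mem_univ, true_and, mem_union] at hT ⊢
    have hT' : S ⊔ (I ⊓ T) = T := sup_inf_eq_of_mem_cube hT.1 hT.2
    rcases good_or_good_compl_of_le (X := I ⊓ T) hca hdisj hIa hIb with h | h
    · rw [hT'] at h
      exact Or.inl ⟨hT, h⟩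
    · rw [inf_compl_inf_eq] at h
      exact Or.inr ⟨hT, h⟩
  -- the preimage of `Good₂` under the involution has the same size as `Good₂`
  have hbij : (univ.filter fun T : Config E => (S ≤ T ∧ T ≤ S ⊔ I) ∧
        G.WalkAvoiding (S ⊔ (I ⊓ Tᶜ)) (G.cluster (S ⊔ (I ⊓ Tᶜ))ᶜ b) c a).card =
      (univ.filter fun T : Config E => (S ≤ T ∧ T ≤ S ⊔ I) ∧
        G.WalkAvoiding T (G.cluster Tᶜ b) c a).card := by
    refine Finset.card_bij (fun T _ => S ⊔ (I ⊓ Tᶜ)) ?_ ?_ ?_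
    · intro T hT
      simp only [mem_filter, mem_univ, true_and] at hT ⊢
      exact ⟨⟨le_sup_left, sup_le_sup_left inf_le_left S⟩, hT.2⟩
    · intro T₁ hT₁ T₂ hT₂ h
      simp only [mem_filter, mem_univ, true_and] at hT₁ hT₂
      have := congrArg (fun U => S ⊔ (I ⊓ Uᶜ)) h
      simp only [cube_compl_compl_of_le hI hT₁.1.1 hT₁.1.2,
        cube_compl_compl_of_le hI hT₂.1.1 hT₂.1.2] at this
      exact this
    · intro T hT
      simp only [mem_filter, mem_univ, true_and] at hT
      refine ⟨S ⊔ (I ⊓ Tᶜ), ?_, cube_compl_compl_of_le hI hT.1.1 hT.1.2⟩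
      simp only [mem_filter, mem_univ, true_and]
      refine ⟨⟨le_sup_left, sup_le_sup_left inf_le_left S⟩, ?_⟩
      rw [cube_compl_compl_of_le hI hT.1.1 hT.1.2]
      exact hT.2
  calc (univ.filter fun T : Config E => S ≤ T ∧ T ≤ S ⊔ I).card
      ≤ ((univ.filter fun T : Config E => (S ≤ T ∧ T ≤ S ⊔ I) ∧
            G.WalkAvoiding T (G.cluster Tᶜ a) c b) ∪
          (univ.filter fun T : Config E => (S ≤ T ∧ T ≤ S ⊔ I) ∧
            G.WalkAvoiding (S ⊔ (I ⊓ Tᶜ)) (G.cluster (S ⊔ (I ⊓ Tᶜ))ᶜ b) c a)).card :=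
        Finset.card_le_card hcover
    _ ≤ (univ.filter fun T : Config E => (S ≤ T ∧ T ≤ S ⊔ I) ∧
            G.WalkAvoiding T (G.cluster Tᶜ a) c b).card +
          (univ.filter fun T : Config E => (S ≤ T ∧ T ≤ S ⊔ I) ∧
            G.WalkAvoiding (S ⊔ (I ⊓ Tᶜ)) (G.cluster (S ⊔ (I ⊓ Tᶜ))ᶜ b) c a).card :=
        Finset.card_union_le _ _
    _ = _ := by rw [hbij]

end Cube

end MultiGraph

end PercRepro
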